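import Mathlib.AlgebraicTopology.EilenbergSteenrod
import Mathlib.Topology.Category.TopPair
import Mathlib.Topology.Category.TopCat.EpiMono
import Mathlib.AlgebraicTopology.SingularHomology.HomotopyInvariance
import Mathlib.Algebra.Homology.HomologySequenceLemmas
import Mathlib.CategoryTheory.Limits.Shapes.Kernels
import Literature.AlgebraicTopology.SingularHomology.SingularChains
import Literature.AlgebraicTopology.SingularHomology.RelativeHomology
import HarnessLib

-- provenance: harness21/H21/H21/Prelude/AlgTop/EilenbergSteenrod.lean @ 99832fe (interim HEAD d8f2665); M5 mechanical rewrite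
/-!
# Singular homology as an Eilenberg–Steenrod pretheory (trunk G04 AlgTop, item C4)

We package relative singular homology with coefficients in an `R`-module `M` as a value of
Mathlib's structure `TopPair.HomologyPretheory`
(`Mathlib/AlgebraicTopology/EilenbergSteenrod.lean`):
functors `Hₚ i : TopPair ⥤ ModuleCat R` (relative homology of a pair, a pair being an embedding
`A ⟶ X` in `TopCat`), `H i : TopCat ⥤ ModuleCat R` (absolute homology), the natural isomorphism
`H i ≅ incl ⋙ Hₚ i` (`Hₙ(X) ≅ Hₙ(X, ∅)`) and the connecting natural transformations
`δ i j : Hₚ i ⟶ proj₂ ⋙ H j` (Eilenberg–Steenrod, *Foundations of Algebraic Topology* (1952), Ch. I,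
§3 and Ch. VII; Hatcher, *Algebraic Topology* (2002), §2.1 and §2.3, "Axioms for homology").

We then *state* the Eilenberg–Steenrod axioms for this pretheory as theorems: homotopy invariance
(`TopPair.HomologyPretheory.IsHomotopyInvariant`, with Mathlib's `TopPair.Homotopy`), excision, and
the dimension axiom. Exactness is item C2's long exact sequence
(`Literature.relativeSingularHomology.exact_*`), which is *the same object*: on pairs of the form
`TopPair.ofSubset A` the functor `Hₚ i` is definitionally `Literature.relativeSingularHomology R M X A i`
(`singularHomologyPretheory.hₚObjOfSubsetIso := Iso.refl _`).

Mathlib (pinned) has the abstract structure `TopPair.HomologyPretheory`, the category `TopPair`,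
the absolute functors `AlgebraicTopology.singularChainComplexFunctor` /
`AlgebraicTopology.singularHomologyFunctor` and the homology sequence API
(`CategoryTheory.ShortComplex.ShortExact.δ`, `HomologicalComplex.HomologySequence.δ_naturality`,
`CategoryTheory.Limits.coker`); it has no singular-homology instance of the pretheory. Everything
here is a thin layer over these.

## Conventions

As in the whole trunk: coefficients `R : Type v` `[CommRing R]`, `M : Type v` an `R`-module; pairs
`X : TopPair.{u}`; all objects in `ModuleCat.{max u v} R`; the coefficient object handed to Mathlib
is `ModuleCat.of R (ULift.{u} M)`. Everything is generic in `R`.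

## Main definitions

* `Literature.singularChainsFunctor R M : TopCat ⥤ ChainComplex (ModuleCat R) ℕ`, an abbreviation for
  Mathlib's `singularChainComplexFunctor` at the coefficient object.
* `Literature.singularRelativeChainsFunctor R M : TopPair ⥤ ChainComplex (ModuleCat R) ℕ`, the relative
  singular chains `(X, A) ↦ C_•(X; M) / C_•(A; M)`, with the short exact sequence
  `singularRelativeChainsFunctor.shortExact`.
* `Literature.singularHomologyPretheory R M :
  TopPair.HomologyPretheory (ModuleCat R) (ComplexShape.down ℕ)`; its absolute part `H i` is
  Mathlib's `(singularHomologyFunctor _ i).obj (ModuleCat.of R (ULift M))`, its relative part on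
  `TopPair.ofSubset A` is definitionally `Literature.relativeSingularHomology R M X A i`
  (`singularHomologyPretheory.hₚObjOfSubsetIso`, `hₚ_map_ofSubsetHom`, `δ_app`).
* `Literature.ofSubsetHom f h`: the morphism of pairs `(X, A) ⟶ (Y, B)` in `TopPair` given by a
  continuous `f` with `f '' A ⊆ B`.
* Axioms (theorems, sorried where they are genuine theorems of the literature):
  `isHomotopyInvariant_singularHomologyPretheory`,
  `singularHomologyPretheory.isIso_hₚ_map_of_closure_subset_interior` (excision),
  `isZero_singularHomologyPretheory_h_obj_of_subsingleton` (dimension).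

No `instance` of `IsHomotopyInvariant` is declared (its only content would be a sorried theorem).

## References

* S. Eilenberg, N. Steenrod, *Foundations of Algebraic Topology*, Princeton UP 1952, Ch. I §3,
  Ch. VII.
* A. Hatcher, *Algebraic Topology*, CUP 2002, §2.1, §2.3.
-/

noncomputable section

open CategoryTheory Limits AlgebraicTopology

universe u v

namespace Literature.AlgebraicTopology.SingularHomology

variable (R : Type v) [CommRing R] (M : Type v) [AddCommGroup M] [Module R M]

/-- Mathlib's singular chain complex functor `X ↦ C_•(X; M)` on `TopCat`, at the H21 coefficient
object `ModuleCat.of R (ULift.{u} M)` (Hatcher 2002, §2.1); an abbreviation, so that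
`(singularChainsFunctor R M).obj (TopCat.of X) = singularChainComplex R M X` and
`(singularChainsFunctor R M).map (TopCat.ofHom f) = singularChainComplex.map R M f` are syntactic
after unfolding. [cite: Hatcher2002, §2.1] -/
abbrev singularChainsFunctor : TopCat.{u} ⥤ ChainComplex (ModuleCat.{max u v} R) ℕ :=
  (singularChainComplexFunctor (ModuleCat.{max u v} R)).obj (ModuleCat.of R (ULift.{u} M))

/-! ### Relative singular chains as a functor on `TopPair` -/

/-- The relative singular chain complex functor `(X, A) ↦ C_•(X, A; M) := coker (C_•(A) ⟶ C_•(X))`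
on Mathlib's category `TopPair` of topological pairs (embeddings `A ⟶ X`)
(Eilenberg–Steenrod 1952, Ch. VII; Hatcher 2002, §2.1, "Exact sequences and excision"):
forget the embedding property, apply the singular chain functor to the arrow, take the cokernel
(`CategoryTheory.Limits.coker`). [cite: EilenbergSteenrod1952, Ch. VII] -/
def singularRelativeChainsFunctor : TopPair.{u} ⥤ ChainComplex (ModuleCat.{max u v} R) ℕ :=
  MorphismProperty.Arrow.forget _ _ _ ⋙ (singularChainsFunctor R M).mapArrow ⋙ Limits.coker _

namespace singularRelativeChainsFunctor

/-- On a pair `(X, A)` with `A : Set X` the relative chains functor is *definitionally* item C2's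
`relativeSingularChainComplex R M X A` (Hatcher 2002, §2.1). [cite: Hatcher2002, §2.1] -/
lemma obj_ofSubset (X : Type u) [TopologicalSpace X] (A : Set X) :
    (singularRelativeChainsFunctor R M).obj (TopPair.ofSubset (X := TopCat.of X) A) =
      relativeSingularChainComplex R M X A :=
  rfl

/-- The chain map `C_•(A; M) ⟶ C_•(X; M)` induced by the structure embedding `A ⟶ X` of a pair
(Hatcher 2002, §2.1): the singular chain functor applied to `X.map`. [cite: Hatcher2002, §2.1] -/
abbrev ι (X : TopPair.{u}) :
    (singularChainsFunctor R M).obj X.snd ⟶ (singularChainsFunctor R M).obj X.fst :=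
  (singularChainsFunctor R M).map X.map

/-- The quotient chain map `C_•(X; M) ⟶ C_•(X, A; M)` of a pair (Hatcher 2002, §2.1);
`cokernel.π`. [cite: Hatcher2002, §2.1] -/
abbrev π (X : TopPair.{u}) :
    (singularChainsFunctor R M).obj X.fst ⟶ (singularRelativeChainsFunctor R M).obj X :=
  cokernel.π (ι R M X)

/-- `C_•(A) ⟶ C_•(X)` is a monomorphism for every pair: an embedding is injective, hence a mono in
`TopCat`, and the singular chain functor preserves monomorphisms (Hatcher 2002, §2.1: chains on
`A` form a subcomplex). [cite: Hatcher2002, §2.1: chains on  A  form a subcomplex] -/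
theorem mono_ι (X : TopPair.{u}) : Mono (ι R M X) := by
  haveI : Mono X.map := (TopCat.mono_iff_injective _).2 X.isEmbedding_map.injective
  exact Functor.map_mono _ _

/-- Naturality of `π`: for a morphism of pairs `f`, `π ≫ C_•(f) = C_•(f.fst) ≫ π`
(Hatcher 2002, §2.1); `cokernel.π_desc`. [cite: Hatcher2002, §2.1] -/
@[reassoc]
lemma π_comp_map {X Y : TopPair.{u}} (f : X ⟶ Y) :
    π R M X ≫ (singularRelativeChainsFunctor R M).map f =
      (singularChainsFunctor R M).map (TopPair.Hom.fst f) ≫ π R M Y :=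
  cokernel.π_desc _ _ _

/-- The short complex of chain complexes `C_•(A) ⟶ C_•(X) ⟶ C_•(X, A)` of a pair
(Hatcher 2002, §2.1, display before Thm. 2.13). [cite: Hatcher2002, §2.1  display before Thm. 2.13] -/
abbrev shortComplex (X : TopPair.{u}) : ShortComplex (ChainComplex (ModuleCat.{max u v} R) ℕ) :=
  ShortComplex.mk (ι R M X) (π R M X) (cokernel.condition _)

/-- The sequence `0 ⟶ C_•(A) ⟶ C_•(X) ⟶ C_•(X, A) ⟶ 0` of a pair is short exact
(Hatcher 2002, §2.1, display before Thm. 2.13); `π` is the cokernel of the mono `ι`. [cite: Hatcher2002, §2.1  display before Thm. 2.13] -/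
theorem shortExact (X : TopPair.{u}) : (shortComplex R M X).ShortExact := by
  haveI := mono_ι R M X
  haveI : Epi (shortComplex R M X).g := inferInstanceAs (Epi (cokernel.π _))
  exact ShortComplex.ShortExact.mk'
    (ShortComplex.exact_of_g_is_cokernel _ (cokernelIsCokernel _)) inferInstance inferInstance

/-- The morphism of short exact sequences of chain complexes induced by a morphism of pairs
(Hatcher 2002, §2.1, naturality of the long exact sequence). [cite: Hatcher2002, §2.1  naturality of the long exact seque] -/
def shortComplexMap {X Y : TopPair.{u}} (f : X ⟶ Y) : shortComplex R M X ⟶ shortComplex R M Y :=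
  ShortComplex.homMk ((singularChainsFunctor R M).map (TopPair.Hom.snd f))
    ((singularChainsFunctor R M).map (TopPair.Hom.fst f))
    ((singularRelativeChainsFunctor R M).map f)
    (by
      change (singularChainsFunctor R M).map _ ≫ (singularChainsFunctor R M).map _ =
        (singularChainsFunctor R M).map _ ≫ (singularChainsFunctor R M).map _
      rw [← Functor.map_comp, ← Functor.map_comp, TopPair.Hom.w])
    (π_comp_map R M f).symm

end singularRelativeChainsFunctor

/-- If the subspace of a pair is empty, `π : C_•(X) ⟶ C_•(X, A)` induces isomorphisms on
homology (indeed `C_•(A) = 0`, so `π` is an isomorphism) (Hatcher 2002, §2.1: `Hₙ(X, ∅) = Hₙ(X)`).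
Used for the field `iso : H i ≅ incl ⋙ Hₚ i` of the pretheory. [cite: Hatcher2002, §2.1:  Hₙ(X  ∅] -/
theorem isIso_homologyMap_cokernel_π_of_isEmpty (X : TopPair.{u}) [IsEmpty X.snd] (i : ℕ) :
    IsIso (HomologicalComplex.homologyMap
      (cokernel.π (singularRelativeChainsFunctor.ι R M X)) i) := by
  have h0 : singularRelativeChainsFunctor.ι R M X = 0 := by
    ext n : 1
    exact singularChainComplex.hom_ext (X := X.snd) fun σ _ ↦
      isEmptyElim (SingularSimplex.toContinuousMap σ (Classical.arbitrary _))
  haveI := cokernel.π_of_zero h0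
  exact inferInstanceAs (IsIso ((HomologicalComplex.homologyFunctor _ _ i).map (cokernel.π _)))

/-! ### The pretheory -/

namespace singularHomologyPretheory

/-- The connecting natural transformation `∂ : Hᵢ(X, A) ⟶ Hⱼ(A)` for `j + 1 = i`
(Eilenberg–Steenrod 1952, Ch. I §3, axiom 3; Hatcher 2002, §2.1, naturality after Thm. 2.16):
components `ShortComplex.ShortExact.δ`, naturality `HomologySequence.δ_naturality`.
Relies on: `singularRelativeChainsFunctor.shortExact` (proved). [cite: EilenbergSteenrod1952, Ch. I §3  axiom 3] -/
def δNatTrans (i j : ℕ) (h : j + 1 = i) :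
    singularRelativeChainsFunctor.{u, v} R M ⋙ HomologicalComplex.homologyFunctor _ _ i ⟶
      TopPair.proj₂ ⋙ (singularHomologyFunctor (ModuleCat.{max u v} R) j).obj
        (ModuleCat.of R (ULift.{u} M)) where
  app X := (singularRelativeChainsFunctor.shortExact R M X).δ i j h
  naturality X Y f :=
    (HomologicalComplex.HomologySequence.δ_naturality
      (singularRelativeChainsFunctor.shortComplexMap R M f)
      (singularRelativeChainsFunctor.shortExact R M X)
      (singularRelativeChainsFunctor.shortExact R M Y) i j h).symm

end singularHomologyPretheory

/-- Singular homology with coefficients in `M` as an Eilenberg–Steenrod pretheory on `TopPair`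
(Eilenberg–Steenrod 1952, Ch. I §3 and Ch. VII; Hatcher 2002, §2.3): `Hₚ i (X, A) = Hᵢ(X, A; M)`
(homology of `singularRelativeChainsFunctor`), `H i X = Hᵢ(X; M)` (Mathlib's
`singularHomologyFunctor`), `iso` induced by `π : C_•(X) ⟶ C_•(X, ∅)`, and `δ i j = ∂` if
`j + 1 = i`, `0` otherwise.
Relies on: `singularRelativeChainsFunctor.shortExact` (proved),
`isIso_homologyMap_cokernel_π_of_isEmpty` (proved). [cite: EilenbergSteenrod1952, Ch. I §3 and Ch. VII] -/
def singularHomologyPretheory :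
    TopPair.HomologyPretheory.{u} (ModuleCat.{max u v} R) (ComplexShape.down ℕ) where
  Hₚ i := singularRelativeChainsFunctor R M ⋙ HomologicalComplex.homologyFunctor _ _ i
  H i := (singularHomologyFunctor (ModuleCat.{max u v} R) i).obj (ModuleCat.of R (ULift.{u} M))
  iso i := NatIso.ofComponents
    (fun X ↦
      haveI : IsEmpty (TopPair.ofTopCat X).snd := inferInstanceAs (IsEmpty PEmpty)
      @asIso _ _ _ _ (HomologicalComplex.homologyMap
        (cokernel.π (singularRelativeChainsFunctor.ι R M (TopPair.ofTopCat X))) i)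
        (isIso_homologyMap_cokernel_π_of_isEmpty R M (TopPair.ofTopCat X) i))
    (by
      intro X Y f
      have h := congrArg (HomologicalComplex.homologyMap · i)
        (singularRelativeChainsFunctor.π_comp_map R M (TopPair.incl.map f))
      simp only [HomologicalComplex.homologyMap_comp] at h
      exact h.symm)
  δ i j := if h : j + 1 = i then singularHomologyPretheory.δNatTrans R M i j h else 0
  shape_δ i j h := dif_neg h

namespace singularHomologyPretheory

/-- On a space `X : Type u` the absolute homology of the pretheory is `Literature.singularHomology R M X i`
(Hatcher 2002, §2.1), definitionally. [cite: Hatcher2002, §2.1] -/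
lemma h_obj_of (X : Type u) [TopologicalSpace X] (i : ℕ) :
    ((singularHomologyPretheory R M).H i).obj (TopCat.of X) = singularHomology R M X i :=
  rfl

/-- The connecting map of the pretheory in degrees `(j + 1, j)` is the connecting homomorphism
`ShortComplex.ShortExact.δ` of `0 ⟶ C_•(A) ⟶ C_•(X) ⟶ C_•(X, A) ⟶ 0`
(Hatcher 2002, §2.1, Thm. 2.13 ff.). [cite: Hatcher2002, §2.1  Thm. 2.13 ff] -/
lemma δ_app (j : ℕ) (X : TopPair.{u}) :
    ((singularHomologyPretheory R M).δ (j + 1) j).app X =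
      (singularRelativeChainsFunctor.shortExact R M X).δ (j + 1) j rfl := by
  change (dite (j + 1 = j + 1) _ _ : (singularHomologyPretheory R M).Hₚ (j + 1) ⟶ _).app X = _
  rw [dif_pos rfl]
  rfl

/-- Comparison with item C2: on the pair `TopPair.ofSubset A` of a subset `A : Set X`, the relative
homology functor `Hₚ i` of the pretheory *is* `Literature.relativeSingularHomology R M X A i`
(Hatcher 2002, §2.1); the isomorphism is `Iso.refl`. This is periods' "relative homology as a
pretheory instance". [cite: Hatcher2002, §2.1] -/
def hₚObjOfSubsetIso (X : Type u) [TopologicalSpace X] (A : Set X) (i : ℕ) :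
    ((singularHomologyPretheory R M).Hₚ i).obj (TopPair.ofSubset (X := TopCat.of X) A) ≅
      relativeSingularHomology R M X A i :=
  Iso.refl _

end singularHomologyPretheory

/-! ### Morphisms of pairs of subsets and the axioms -/

variable {X Y : Type u} [TopologicalSpace X] [TopologicalSpace Y]

/-- The morphism of pairs `(X, A) ⟶ (Y, B)` in `TopPair` given by a continuous map `f : X → Y` with
`f '' A ⊆ B` (Hatcher 2002, §2.1, "maps of pairs"; Eilenberg–Steenrod 1952, Ch. I §1): first
component `f`, second component the restriction `Literature.subsetRestrict f h : A → B`. [cite: Hatcher2002, §2.1  "maps of pairs"] -/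
def ofSubsetHom {A : Set X} {B : Set Y} (f : C(X, Y)) (h : Set.MapsTo f A B) :
    TopPair.ofSubset (X := TopCat.of X) A ⟶ TopPair.ofSubset (X := TopCat.of Y) B :=
  TopPair.ofHom (TopCat.ofHom f) (TopCat.ofHom (subsetRestrict f h)) rfl

/-- Under the identification `hₚObjOfSubsetIso = Iso.refl`, the pretheory's induced map of a map
of pairs is item C2's `relativeSingularHomology.map` (Hatcher 2002, §2.1). [cite: Hatcher2002, §2.1] -/
lemma singularHomologyPretheory.hₚ_map_ofSubsetHom {A : Set X} {B : Set Y} (f : C(X, Y))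
    (h : Set.MapsTo f A B) (i : ℕ) :
    ((singularHomologyPretheory R M).Hₚ i).map (ofSubsetHom f h) =
      relativeSingularHomology.map R M f h i :=
  rfl

/-- Homotopy axiom for singular homology as a pretheory: homotopic morphisms of pairs
(Mathlib's `TopPair.Homotopy`, a pair of compatible homotopies on both spaces) induce the same map
on `Hₙ(X, A; M)` (Eilenberg–Steenrod 1952, Ch. I §3, Axiom 5; Hatcher 2002, Prop. 2.19 and §2.3).
No `instance` is declared from this theorem. [cite: EilenbergSteenrod1952, Ch. I §3  Axiom 5] -/
def isHomotopyInvariant_singularHomologyPretheory : Prop :=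
  (singularHomologyPretheory.{u, v} R M).IsHomotopyInvariant

/-- Excision axiom for singular homology as a pretheory: if `closure U ⊆ interior A` then the
inclusion of pairs `(X ∖ U, A ∖ U) ⟶ (X, A)` induces isomorphisms on relative homology
(Eilenberg–Steenrod 1952, Ch. I §3, Axiom 6; Hatcher 2002, Thm. 2.20). Here `X ∖ U` is the subtype
`↥Uᶜ` and `A ∖ U` the preimage `Subtype.val ⁻¹' A`. [cite: EilenbergSteenrod1952, Ch. I §3  Axiom 6] -/
def singularHomologyPretheory.isIso_hₚ_map_of_closure_subset_interior : Prop :=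
  ∀ {A U : Set X} (hU : closure U ⊆ interior A) (i : ℕ),
    IsIso (((singularHomologyPretheory R M).Hₚ i).map
      (ofSubsetHom (A := (Subtype.val ⁻¹' A : Set ↥Uᶜ)) (B := A)
        (⟨Subtype.val, continuous_subtype_val⟩ : C(↥Uᶜ, X)) fun _ hx ↦ hx))

/-- Dimension axiom for singular homology as a pretheory: the homology of a subsingleton space
(e.g. a point) vanishes in nonzero degrees (Eilenberg–Steenrod 1952, Ch. I §3, Axiom 7;
Hatcher 2002, Prop. 2.8); from `Literature.AlgebraicTopology.SingularHomology.isZero_singularHomology_of_subsingleton`. [cite: EilenbergSteenrod1952, Ch. I §3  Axiom 7] -/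
theorem isZero_singularHomologyPretheory_h_obj_of_subsingleton (X : Type u) [TopologicalSpace X]
    [Subsingleton X] {i : ℕ} (hi : i ≠ 0) :
    IsZero (((singularHomologyPretheory R M).H i).obj (TopCat.of X)) :=
  isZero_singularHomology_of_subsingleton R M hi

end Literature.AlgebraicTopology.SingularHomology
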